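import Literature.NumberTheory.EllipticCurves.HasseManin
import Literature.NumberTheory.EllipticCurves.FunctionFieldTranslation
import Literature.NumberTheory.DiophantineGeometry.WeierstrassFunctionFieldPlaces
import HarnessLib

/-!
# The Lang torsor of an elliptic curve over a finite field, I: the translation automorphisms of
`k(E)` over an arbitrary base field

Topic `NumberTheory/EllipticCurves`. First file of the arithmetic half of the discharge of the named
fact `Literature.NumberTheory.EllipticCurves.KohelShparlinski.CoordinateCharSumBound`
(`KohelShparlinskiCharacterSums`): the unramified abelian covering `1 - φ : E → E` (`φ` the `q`-power
Frobenius), whose Galois group is `E(k)` acting by translations ("Lang torsor"; Lang 1956, Serre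
*Groupes algébriques et corps de classes* VI §6), realised on function fields over the finite field
`k` itself.

**Relation to the tree (duplicate search).** `Literature.NumberTheory.EllipticCurves.FunctionFieldTranslation`
already provides (i) the evaluation layer over an ARBITRARY base field `k` — the point map
`WeierstrassFunctionField.pointAlgHom V u v h : k[V] →ₐ[k] A` of a solution `(u, v)` of the
equation in a `k`-algebra, its injectivity for transcendental `u` (`pointAlgHom_injective`), the
extension `funcAlgHom u v h hu : k(V) →ₐ[k] F'`, the generic coordinates `xF, yF` and
`algHom_ext_xy` — which this file REUSES (the thin wrapper `fieldEnd` only converts Mathlib's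
`Affine.Equation` over the function field and "`x` non-constant" into that API's hypotheses); and
(ii) the translations `WeierstrassCurve.transAlgHom / transAlgEquiv / transHom`, `constPoint`,
`algHom_eq_of_map_genericPoint_eq`, but ONLY over `K̄ = AlgebraicClosure K` (geometric function field
`W.geomFunctionField`, as needed for isogeny degrees). The Lang torsor lives over the finite field
`k` (its Galois group is `E(k)`, not `E(k̄)`), so this file GENERALISES (ii) to an arbitrary base
field `k` and the function field `k(W) = W.toAffine.FunctionField` of Mathlib, with the generic point
`HasseManin.genPt` of the tree's Manin files (whose Frobenius point and degree computation the sequel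
uses):

* `exists_eq_algebraMap_of_isAlgebraic` (`k` is the full constant field of `k(W)`, from
  `WeierstrassFunctionFieldPlaces.isIntegrallyClosedIn`), `transcendental_of_not_mem_range`;
* `fieldEnd W x y h hx : k(W) →ₐ[k] k(W)` — `funcAlgHom` of a point `(x, y) ∈ W(k(W))` with `x`
  non-constant; `fieldEnd_gT`, `fieldEnd_gS`, **`map_fieldEnd_genPt`** (it sends the generic point
  `Q = (t, s)` to `(x, y)`), `algHom_eq_of_map_genPt_eq`;
* constant points `constPt W : W(k) →+ W(k(W))` (Mathlib's `Point.baseChange`), a point with constant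
  `x`-coordinate is constant (`exists_constPt_eq_of_xc_mem`), the generic point and its translates
  are not (`genPt_not_mem_range`, `genPt_add_constPt_not_mem_range`);
* **the translations** `transl T : k(W) →ₐ[k] k(W)` (evaluation at `Q + T`), `map_transl_genPt`,
  `transl_zero`, `transl_add` (`τ_{T+T'} = τ_T ∘ τ_{T'}`, from the additivity of Mathlib's
  `Point.map`), `translEquiv T : k(W) ≃ₐ[k] k(W)`, the homomorphism
  `translHom W : Multiplicative W(k) →* (k(W) ≃ₐ[k] k(W))` and its injectivity (faithfulness:
  `τ_T = 1 ⇒ T = O`). (Silverman *AEC* III.4.7: `τ_T`; III.4.10 (b), proof pp. 72–73: the induced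
  automorphisms of the function field.)

The sequel `LangTorsorFrobenius` constructs `λ = (φ - 1)^*` as evaluation at Manin's point
`P₋₁ = (t^q, s^q) - (t, s)`, shows that the translations fix `λ(k(W))`, computes
`[k(W) : λ k(W)] = #W(k)` and deduces that `k(W)/λ(k(W))` is Galois with group `W(k)`.

## References

* S. Lang, *Algebraic groups over finite fields*, Amer. J. Math. 78 (1956), 555–563.
* J.-P. Serre, *Algebraic Groups and Class Fields*, GTM 117, Ch. VI §4, §6 (the isogeny `℘ = F - 1`).
* J. H. Silverman, *The Arithmetic of Elliptic Curves*, 2nd ed., GTM 106, III.4.7, III.4.10(b)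
  (pp. 72–73), V.§1. [SilvermanAEC2009]
-/

noncomputable section

open Polynomial WeierstrassCurve WeierstrassCurve.Affine
open scoped Polynomial.Bivariate

namespace Literature.NumberTheory.EllipticCurves.LangTorsor

open HasseManin WeierstrassFunctionField

universe u v w

variable {F : Type u} [Field F] (W : WeierstrassCurve F)

/-! ### Over the function field: constants, and the endomorphism attached to a point -/

section FunctionField

variable {W} [W.IsElliptic]

/-- An element of `k(W)` which is algebraic over `k` is a constant: `k` is the full constant field
of the function field of an elliptic curve (`WeierstrassFunctionFieldPlaces.isIntegrallyClosedIn`).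
[cite: SilvermanAEC2009, Prop. II.1.2] -/
theorem exists_eq_algebraMap_of_isAlgebraic {z : W.toAffine.FunctionField} (hz : IsAlgebraic F z) :
    ∃ c : F, algebraMap F W.toAffine.FunctionField c = z :=
  IsIntegrallyClosedIn.algebraMap_eq_of_integral hz.isIntegral

/-- A non-constant element of `k(W)` is transcendental over `k`. [folklore] -/
theorem transcendental_of_not_mem_range {z : W.toAffine.FunctionField}
    (hz : z ∉ Set.range (algebraMap F W.toAffine.FunctionField)) : Transcendental F z :=
  fun h => hz (exists_eq_algebraMap_of_isAlgebraic h)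

omit [W.IsElliptic] in
/-- Mathlib's Weierstrass equation over an extension `L/k`, in the form consumed by
`WeierstrassFunctionField.pointAlgHom`. [folklore] -/
theorem evalEval_map_polynomial_eq_zero {L : Type v} [Field L] [Algebra F L] {x y : L}
    (h : (W.baseChange L).toAffine.Equation x y) :
    (W.toAffine.polynomial.map (mapRingHom (algebraMap F L))).evalEval x y = 0 := by
  rw [← WeierstrassCurve.Affine.map_polynomial]
  exact h

/-- **The field endomorphism attached to a point.** For a point `(x, y)` of `W` over `K = k(W)` with
`x ∉ k`, the `k`-algebra endomorphism of `K` sending the generic coordinates to `(x, y)`: the tree's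
`WeierstrassFunctionField.funcAlgHom` (pull-back along the rational map `E → E` with generic value
`(x, y)`), fed with `transcendental_of_not_mem_range`. [folklore] -/
abbrev fieldEnd (x y : W.toAffine.FunctionField)
    (h : (W.baseChange W.toAffine.FunctionField).toAffine.Equation x y)
    (hx : x ∉ Set.range (algebraMap F W.toAffine.FunctionField)) :
    W.toAffine.FunctionField →ₐ[F] W.toAffine.FunctionField :=
  funcAlgHom x y (evalEval_map_polynomial_eq_zero h) (transcendental_of_not_mem_range hx)

/-- `fieldEnd (x, y)` sends `t` to `x`. [folklore] -/
@[simp]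
theorem fieldEnd_gT (x y : W.toAffine.FunctionField)
    (h : (W.baseChange W.toAffine.FunctionField).toAffine.Equation x y)
    (hx : x ∉ Set.range (algebraMap F W.toAffine.FunctionField)) : fieldEnd x y h hx (gT W) = x :=
  funcAlgHom_xF x y _ _

/-- `fieldEnd (x, y)` sends `s` to `y`. [folklore] -/
@[simp]
theorem fieldEnd_gS (x y : W.toAffine.FunctionField)
    (h : (W.baseChange W.toAffine.FunctionField).toAffine.Equation x y)
    (hx : x ∉ Set.range (algebraMap F W.toAffine.FunctionField)) : fieldEnd x y h hx (gS W) = y :=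
  funcAlgHom_yF x y _ _

omit [W.IsElliptic] in
/-- Two `k`-algebra maps out of `k(W)` agreeing on `t` and `s` are equal (the tree's
`WeierstrassFunctionField.algHom_ext_xy`, restated for `HasseManin.gT/gS`). [folklore] -/
theorem algHom_functionField_ext {T : Type w} [Field T] [Algebra F T]
    {f g : W.toAffine.FunctionField →ₐ[F] T} (hT : f (gT W) = g (gT W)) (hS : f (gS W) = g (gS W)) :
    f = g :=
  algHom_ext_xy hT hS

/-- **`fieldEnd (x, y)` maps the generic point to `(x, y)`.** [folklore] -/
theorem map_fieldEnd_genPt (x y : W.toAffine.FunctionField)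
    (h : (W.baseChange W.toAffine.FunctionField).toAffine.Nonsingular x y)
    (hx : x ∉ Set.range (algebraMap F W.toAffine.FunctionField)) :
    Point.map (fieldEnd x y h.left hx) (genPt W) = .some x y h := by
  rw [genPt_eq, Point.map_some]
  congr 1
  · exact fieldEnd_gT x y h.left hx
  · exact fieldEnd_gS x y h.left hx

/-! ### Constant points and the translations -/

variable [DecidableEq F]

variable (W) in
/-- The constant points: `W(k) → W(k(W))`. [folklore] -/
def constPt : W.toAffine.Point →+ (W.baseChange W.toAffine.FunctionField).toAffine.Point :=
  Affine.Point.baseChange (W' := W) F W.toAffine.FunctionField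

omit [W.IsElliptic] in
/-- `constPt` is injective. [folklore] -/
theorem constPt_injective : Function.Injective (constPt W) :=
  Affine.Point.map_injective (W' := W) _

omit [W.IsElliptic] in
/-- Constant points are fixed by every `k`-algebra endomorphism of `k(W)`. [folklore] -/
@[simp]
theorem map_constPt (f : W.toAffine.FunctionField →ₐ[F] W.toAffine.FunctionField) (T : W.toAffine.Point) :
    Point.map f (constPt W T) = constPt W T :=
  Affine.Point.map_baseChange (R := F) (W' := W) (F := F) f T

omit [W.IsElliptic] [DecidableEq F] in
/-- The `x`-coordinate commutes with `k`-algebra endomorphisms. [folklore] -/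
theorem xc_map' (f : W.toAffine.FunctionField →ₐ[F] W.toAffine.FunctionField)
    (P : (W.baseChange W.toAffine.FunctionField).toAffine.Point) : xc W (Point.map f P) = f (xc W P) := by
  cases P
  · exact (map_zero f).symm
  · rfl

omit [W.IsElliptic] in
/-- The `x`-coordinate of an affine constant point is a constant. [folklore] -/
theorem xc_constPt_mem {T : W.toAffine.Point} (hT : T ≠ 0) :
    xc W (constPt W T) ∈ Set.range (algebraMap F W.toAffine.FunctionField) := by
  rcases T with _ | ⟨a, b, hab⟩
  · exact absurd rfl hT
  · exact ⟨a, rfl⟩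

/-- **A point with constant `x`-coordinate is constant**: if `P = (x, y)` with `x = c ∈ k` then `y` is
a root of the monic quadratic `W(c, Y) ∈ k[Y]`, hence algebraic over `k`, hence constant. [folklore] -/
theorem exists_constPt_eq_of_xc_mem {P : (W.baseChange W.toAffine.FunctionField).toAffine.Point}
    (hP : P ≠ 0) (hx : xc W P ∈ Set.range (algebraMap F W.toAffine.FunctionField)) :
    ∃ T : W.toAffine.Point, constPt W T = P := by
  rcases P with _ | ⟨x, y, hxy⟩
  · exact absurd rfl hP
  obtain ⟨c, hc⟩ := hx
  change algebraMap F W.toAffine.FunctionField c = x at hc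
  subst hc
  -- `y` is a root of `fibPoly W c`
  have heq := hxy.left
  rw [Affine.equation_iff] at heq
  simp only [WeierstrassCurve.baseChange, map_a₁, map_a₂, map_a₃, map_a₄, map_a₆] at heq
  have hy : IsAlgebraic F y := by
    refine ⟨fibPoly W c, fibPoly_ne_zero W c, ?_⟩
    rw [Polynomial.aeval_def, eval₂_fibPoly]
    simp only [map_add, map_mul, map_pow]
    linear_combination heq
  obtain ⟨d, rfl⟩ := exists_eq_algebraMap_of_isAlgebraic hy
  have hcd' : (W.baseChange F).toAffine.Equation c d :=
    (baseChange_equation (W := W) (f := Algebra.ofId F W.toAffine.FunctionField)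
      (algebraMap F W.toAffine.FunctionField).injective c d).mp hxy.left
  have hcd : W.toAffine.Nonsingular c d := (nonsingular_iff_equation W F).mpr hcd'
  exact ⟨.some c d hcd, rfl⟩

omit [DecidableEq F] [W.IsElliptic] in
/-- `t ∈ k(W)` is not a constant. [folklore] -/
theorem gT_not_mem_range : gT W ∉ Set.range (algebraMap F W.toAffine.FunctionField) := by
  rintro ⟨c, hc⟩
  rw [gT, IsScalarTower.algebraMap_apply F F[X] W.toAffine.FunctionField, Polynomial.algebraMap_eq] at hc
  exact Polynomial.X_ne_C c (algebraMap_functionField_injective W hc).symm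

/-- **The generic point is not constant.** [folklore] -/
theorem genPt_not_mem_range : genPt W ∉ Set.range (constPt W) := by
  rintro ⟨T, hT⟩
  by_cases hT0 : T = 0
  · rw [hT0, map_zero] at hT
    exact genPt_ne_zero W hT.symm
  · have h := xc_constPt_mem (W := W) hT0
    rw [hT, xc_genPt] at h
    exact gT_not_mem_range h

/-- `Q + T` is not constant, for a constant `T`. [folklore] -/
theorem genPt_add_constPt_not_mem_range (T : W.toAffine.Point) :
    genPt W + constPt W T ∉ Set.range (constPt W) := by
  rintro ⟨T', hT'⟩
  refine genPt_not_mem_range (W := W) ⟨T' - T, ?_⟩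
  rw [map_sub, hT', add_sub_cancel_right]

omit [W.IsElliptic] in
/-- A non-constant point is not `O`. [folklore] -/
theorem ne_zero_of_not_mem_range {P : (W.baseChange W.toAffine.FunctionField).toAffine.Point}
    (hP : P ∉ Set.range (constPt W)) : P ≠ 0 := by
  rintro rfl
  exact hP ⟨0, map_zero _⟩

/-- A non-constant point has non-constant `x`-coordinate. [folklore] -/
theorem xc_not_mem_of_not_mem_range {P : (W.baseChange W.toAffine.FunctionField).toAffine.Point}
    (hP : P ∉ Set.range (constPt W)) : xc W P ∉ Set.range (algebraMap F W.toAffine.FunctionField) :=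
  fun hx => hP (exists_constPt_eq_of_xc_mem (ne_zero_of_not_mem_range hP) hx)

/-- **The field endomorphism attached to a non-constant point** `P` of `W(k(W))`: evaluation at `P`.
[folklore] -/
def fieldEndPt (P : (W.baseChange W.toAffine.FunctionField).toAffine.Point)
    (hP : P ∉ Set.range (constPt W)) : W.toAffine.FunctionField →ₐ[F] W.toAffine.FunctionField :=
  match P, hP with
  | .zero, hP => ((ne_zero_of_not_mem_range hP) rfl).elim
  | .some x y h, hP => fieldEnd x y h.left (xc_not_mem_of_not_mem_range hP)

/-- **`fieldEndPt P` maps the generic point to `P`.** [folklore] -/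
theorem map_fieldEndPt_genPt (P : (W.baseChange W.toAffine.FunctionField).toAffine.Point)
    (hP : P ∉ Set.range (constPt W)) : Point.map (fieldEndPt P hP) (genPt W) = P := by
  rcases P with _ | ⟨x, y, h⟩
  · exact ((ne_zero_of_not_mem_range hP) rfl).elim
  · exact map_fieldEnd_genPt x y h (xc_not_mem_of_not_mem_range hP)

omit [DecidableEq F] in
/-- **A `k`-algebra endomorphism of `k(W)` is determined by the image of the generic point.**
[folklore] -/
theorem algHom_eq_of_map_genPt_eq {f g : W.toAffine.FunctionField →ₐ[F] W.toAffine.FunctionField}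
    (h : Point.map f (genPt W) = Point.map g (genPt W)) : f = g := by
  rw [genPt_eq, Point.map_some, Point.map_some] at h
  obtain ⟨hT, hS⟩ := Point.some.inj h
  exact algHom_functionField_ext hT hS

/-- **The translation `τ_T` by a rational point `T ∈ W(k)`**: the `k`-algebra endomorphism of `k(W)`
given by evaluation at `Q + T` (pull-back along `P ↦ P + T`). [cite: SilvermanAEC2009, III.4.7 and III.4.10(b)] -/
def transl (T : W.toAffine.Point) : W.toAffine.FunctionField →ₐ[F] W.toAffine.FunctionField :=
  fieldEndPt (genPt W + constPt W T) (genPt_add_constPt_not_mem_range T)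

/-- `τ_T` sends the generic point `Q` to `Q + T`. [folklore] -/
@[simp]
theorem map_transl_genPt (T : W.toAffine.Point) :
    Point.map (transl T) (genPt W) = genPt W + constPt W T :=
  map_fieldEndPt_genPt _ _

/-- `τ_O = 1`. [folklore] -/
@[simp]
theorem transl_zero : transl (0 : W.toAffine.Point) = AlgHom.id F W.toAffine.FunctionField := by
  refine algHom_eq_of_map_genPt_eq ?_
  rw [map_transl_genPt, map_zero, add_zero]
  exact (Point.map_id (F := W.toAffine.FunctionField) (genPt W)).symm

/-- **`τ_{T + T'} = τ_T ∘ τ_{T'}`**: both send `Q` to `Q + T + T'`, by the naturality of the group law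
under `Point.map` and since `τ_T` fixes constant points. [cite: SilvermanAEC2009, III.4.7 and III.4.10(b)] -/
theorem transl_add (T T' : W.toAffine.Point) : transl (T + T') = (transl T).comp (transl T') := by
  refine algHom_eq_of_map_genPt_eq ?_
  rw [map_transl_genPt (T + T'), ← Point.map_map, map_transl_genPt T',
    (Point.map (transl T)).map_add, map_transl_genPt T, map_constPt, (constPt W).map_add, add_assoc]

/-- `τ_{-T} ∘ τ_T = 1`. [folklore] -/
theorem transl_neg_comp (T : W.toAffine.Point) : (transl (-T)).comp (transl T) = AlgHom.id F _ := by
  rw [← transl_add, neg_add_cancel, transl_zero]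

/-- `τ_T ∘ τ_{-T} = 1`. [folklore] -/
theorem transl_comp_neg (T : W.toAffine.Point) : (transl T).comp (transl (-T)) = AlgHom.id F _ := by
  rw [← transl_add, add_neg_cancel, transl_zero]

/-- **The translation automorphism** `τ_T : k(W) ≃ₐ[k] k(W)`. [cite: SilvermanAEC2009, III.4.7 and III.4.10(b)] -/
def translEquiv (T : W.toAffine.Point) : W.toAffine.FunctionField ≃ₐ[F] W.toAffine.FunctionField :=
  AlgEquiv.ofAlgHom (transl T) (transl (-T)) (transl_comp_neg T) (transl_neg_comp T)

/-- The underlying endomorphism of `translEquiv T` is `transl T`. [folklore] -/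
@[simp]
theorem coe_translEquiv (T : W.toAffine.Point) :
    (translEquiv T : W.toAffine.FunctionField →ₐ[F] W.toAffine.FunctionField) = transl T :=
  rfl

/-- `translEquiv T z = transl T z`. [folklore] -/
theorem translEquiv_apply (T : W.toAffine.Point) (z : W.toAffine.FunctionField) :
    translEquiv T z = transl T z :=
  rfl

/-- **`T ↦ τ_T` is a group homomorphism** `W(k) → Aut_k k(W)` (with `(e₁ * e₂) z = e₁ (e₂ z)`).
[cite: SilvermanAEC2009, III.4.7 and III.4.10(b)] -/
theorem translEquiv_add (T T' : W.toAffine.Point) :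
    translEquiv (T + T') = translEquiv T * translEquiv T' := by
  apply AlgEquiv.coe_toAlgHom_injective
  rw [coe_translEquiv, transl_add]
  rfl

/-- `τ_O = 1`. [folklore] -/
theorem translEquiv_zero : translEquiv (0 : W.toAffine.Point) = 1 := by
  apply AlgEquiv.coe_toAlgHom_injective
  rw [coe_translEquiv, transl_zero]
  rfl

variable (W) in
/-- The group homomorphism `W(k) → Aut_k k(W)`, `T ↦ τ_T`. [cite: SilvermanAEC2009, III.4.7 and III.4.10(b)] -/
def translHom : Multiplicative W.toAffine.Point →* (W.toAffine.FunctionField ≃ₐ[F] W.toAffine.FunctionField) where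
  toFun T := translEquiv T.toAdd
  map_one' := translEquiv_zero
  map_mul' T T' := translEquiv_add T.toAdd T'.toAdd

/-- `translHom` on `ofAdd T` is `translEquiv T`. [folklore] -/
@[simp]
theorem translHom_ofAdd (T : W.toAffine.Point) : translHom W (Multiplicative.ofAdd T) = translEquiv T :=
  rfl

/-- **Faithfulness**: `τ_T = 1` only for `T = O` (`τ_T` moves `Q` to `Q + T`). [folklore] -/
theorem translEquiv_injective : Function.Injective (translEquiv (W := W)) := by
  intro T T' h
  have h' : transl T = transl T' := by rw [← coe_translEquiv, h, coe_translEquiv]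
  have hpt := congrArg (fun f => Point.map f (genPt W)) h'
  simp only [map_transl_genPt, add_right_inj] at hpt
  exact constPt_injective hpt

/-- `translHom` is injective. [folklore] -/
theorem translHom_injective : Function.Injective (translHom W) := fun _ _ h =>
  Multiplicative.toAdd.injective (translEquiv_injective h)

end FunctionField

end Literature.NumberTheory.EllipticCurves.LangTorsor
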